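import Literature.Computability.QuantumComplexity.CubicForrelationEstimatorAnalysis
import Literature.Computability.QuantumComplexity.SignedCubicForrelation

/-!
# `SignedCubicForrelationNotPrBPP` — negative knowledge: one quadratic side, I (machine and statistic)

Support file for crux `stmt-QuantumAdvantage-13931`
(`Summit.QuantumAdvantage.QuantumAdvantage.Theses.CubicForrelation.SignedCubicForrelationNotPrBPP`,
route `QuantumAdvantage/CubicForrelation`), written by the standing disprover
`refuter-cdisprove-stmt-QuantumAdvantage-13931-0` (2026-08-16). Two files: `HalfQuadMachine.lean`
(this: the randomised machine, its `FP` witness, the one-round statistic and its two moments) and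
`HalfQuadratic.lean` (round = statistic, Chebyshev bounds, the promise problems, membership theorems).

**Target theorem (`HalfQuadratic.lean`).** SIGNED explicit 2-fold Forrelation — YES `Φ ≥ 3/5`, NO
`Φ ≤ -3/5`, `k = 2`, `B₂`-circuits — restricted to instances in which ONE designated circuit `C_j`
(`j ∈ {0,1}`) computes a function of 𝔽₂-degree `≤ 2`, the other circuit being ARBITRARY, is in textbook
`PromiseBPP'`. So the hardness claimed by the crux `X`, if any, needs 𝔽₂-degree exactly `3` on BOTH sides
(the unsigned rung being classical for cubic pairs by `CubicDequant.cubicKForrelationProblem_two_mem_PromiseBPP'`).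

**The algorithm** (length-squared Fourier sampling of the quadratic side; a signed cousin of the
`Φ²`-estimator `CubicDequant.accept`). With `g = C_j` quadratic and `f = C_{1-j}` arbitrary,
`2^{3n/2} Φ(f,g) = Σ_u (-1)^{f(u)} W_g(u)` and the exact sampler `uOf` of
`QuadraticFourierSampler.lean` outputs `u` with probability `W_g(u)²/4ⁿ`; so
`Y = (-1)^{f(u)} · 8ⁿ / W_g(u)` (an integer: `W_g(u) = TOf …` is a signed power of two dividing `8ⁿ`)
has `E[Y] = 2ⁿ · 2^{3n/2} Φ` and `E[Y²] ≤ 2ⁿ · 8ⁿ`: `Y/(2ⁿ 2^{3n/2})` is an unbiased estimator OF `Φ`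
ITSELF with second moment `≤ 1`. The machine averages `N = 16` rounds and accepts iff the sum is
positive (on `⟨instance code, coins⟩`, with the guard `k = 2 ∧ n ≤ |x| + 1` of `CubicDequant`).

Contents: `roundY`, `roundAt`, `sumY`, `accept j`; `CodeFP` proofs assembled from the tree's kits
(`ForrelationCircuitCode`, `QuadraticFourierSampler.{uOf,TOf}_codeFP` with the oracle family
`(c, v) ↦ evalP c v`, `GaussCodeFP`, `CodeFPArith`); the `FP` witness `dec j` and the packaged
criterion `mem_PromiseBPP'_of_accept`; the statistic `Zst` (`Z(w) = (-1)^{f(u)} 2ⁿ / W_g(u)`, `u = uV g w`)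
with `Σ_w Z = √(2^{3n}) Φ` (`sum_Zst_eq`, via `QuadSampler.sum_comp_uV_mul_two_pow`) and `Σ_w Z² ≤ 4ⁿ`
(`sum_Zst_sq_le`), its normalisation `Zn = Z/√(2ⁿ)` (mean `Φ`, second moment `≤ 1`), `forrelation_comm`,
and small bridges for the sequel.

## References

* [AaronsonAmbainis2018] S. Aaronson, A. Ambainis, Forrelation, SIAM J. Comput. 47 (2018), §1.1.1,
  §3.2 Prop. 6 (the sign-sensitive quantum test), §6.
* [MacWilliamsSloane1977] F. J. MacWilliams, N. J. A. Sloane, The Theory of Error-Correcting Codes,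
  Ch. 15 §2 (Dickson; Walsh spectra of quadratic forms).
* [BravyiGosset2016] S. Bravyi, D. Gosset, PRL 116 (2016) 250501, App. A (quadratic Gauss sums).
* [AroraBarak2009] S. Arora, B. Barak, Computational Complexity, §1.3, §7.4.1, Lemma A.12 (Chebyshev).
* [Goldreich2006] O. Goldreich, On promise problems, Def. 1.2.
* [Carlet2020] C. Carlet, Boolean Functions for Cryptography and Coding Theory, §2.2.1.
-/

noncomputable section

namespace Summit.QuantumAdvantage.QuantumAdvantage.Theorems.SignedCubicForrelationNotPrBPP.Negative

namespace HalfQuad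

open _root_.Computability Literature.Computability.Complexity Literature.Computability.Complexity.CodeFP
open Literature.Computability.Complexity.Brick
open Literature.Computability.QuantumComplexity
open ForrCode QuadSampler CubicDequant
open Literature.Computability.Complexity.F2Elim (bxorL bitsE)

/-! ### The decision as a plain function -/

/-- **One round**: from the coins `w` the frequency `u = uOf (C_Q) n w` (exact Fourier sampler of the
quadratic side), the sign `(-1)^{C_S(u)}` of the other side at `u`, and the integer
`Y = (-1)^{C_S(u)} · 8ⁿ / W_{C_Q}(u)`. [cite: AaronsonAmbainis2018, §1.1.1] -/
def roundY (n : ℕ) (cS cQ : PCirc) (w : List Bool) : ℤ :=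
  (if evalP cS (uOf (evalP cQ) n w) then -1 else 1) *
    ((8 : ℤ) ^ n / TOf (evalP cQ) n (uOf (evalP cQ) n w))

/-- Round `r` reads its `n` coins at offset `r n`. [folklore] -/
def roundAt (n : ℕ) (cS cQ : PCirc) (y : List Bool) (r : ℕ) : ℤ :=
  roundY n cS cQ (coinVec y n (r * n))

/-- The number of rounds. [folklore] -/
def N : ℕ := 16

/-- The sum of the `N` round statistics. [folklore] -/
def sumY (n : ℕ) (cS cQ : PCirc) (y : List Bool) : ℤ := ((List.range N).map (roundAt n cS cQ y)).sum

/-- **The decision** (`j` = index of the QUADRATIC circuit, the sign is read off circuit `1 - j`):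
guard `k = 2 ∧ n ≤ L + 1`, then accept iff `Σ_r Y_r > 0`. [cite: AaronsonAmbainis2018, §1.1.3] -/
def accept (j : ℕ) (t : Inst) (L : ℕ) (y : List Bool) : Bool :=
  decide (t.2.1 = 2) && (decide (t.1 ≤ L + 1) &&
    decide (0 < sumY (nEff t L) (circAt t (1 - j)) (circAt t j) y))

/-! ### Polynomial time -/

/-- The oracle family `(c, v) ↦ evalP c v` on codes (bit-list input). [cite: AroraBarak2009, §1.3] -/
theorem evalQ_codeFP : CodeFP (pairE pcE bitsE) bitE (fun t => evalP t.1 t.2) :=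
  evalP_codeFP.comp ((fst _ _).pair (bitsToStr.comp (snd _ _)))

/-- The code of the round context `((n, (c_S, c_Q)), w)`. [folklore] -/
abbrev RE : (ℕ × (PCirc × PCirc)) × List Bool → List Bool := pairE (pairE unE (pairE pcE pcE)) bitsE

/-- **One round on codes.** [cite: AroraBarak2009, §1.3] -/
theorem roundY_codeFP : CodeFP RE intE (fun t => roundY t.1.1 t.1.2.1 t.1.2.2 t.2) := by
  have hn : CodeFP RE unE (fun t => t.1.1) := (fst _ _).fst'
  have hcS : CodeFP RE pcE (fun t => t.1.2.1) := (fst _ _).snd'.fst'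
  have hcQ : CodeFP RE pcE (fun t => t.1.2.2) := (fst _ _).snd'.snd'
  have hw : CodeFP RE bitsE (fun t => t.2) := snd _ _
  have hU := uOf_codeFP (σ := PCirc) (eσ := pcE) (Q := evalP) evalQ_codeFP
  have hT := TOf_codeFP (σ := PCirc) (eσ := pcE) (Q := evalP) evalQ_codeFP
  have hu := hU.comp ((hcQ.pair hn).pair hw)
  have ht := hT.comp ((hcQ.pair hn).pair hu)
  have hs := evalQ_codeFP.comp (hcS.pair hu)
  have hsign := hs.ite (const RE (eβ := intE) (-1 : ℤ)) (const RE (eβ := intE) (1 : ℤ))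
  have h8 := intPow.comp ((const RE (8 : ℤ)).pair hn)
  have hY := intMul.comp (hsign.pair (intEDiv.comp (h8.pair ht)))
  refine hY.congr fun t => ?_
  dsimp only [roundY]

/-- The code of the sum context `((n, (c_S, c_Q)), y)`. [folklore] -/
abbrev SE : (ℕ × (PCirc × PCirc)) × List Bool → List Bool := pairE (pairE unE (pairE pcE pcE)) strE

/-- One indexed round on codes. [cite: AroraBarak2009, §1.3] -/
theorem roundAt_codeFP : CodeFP (pairE SE natE) intE (fun t => roundAt t.1.1.1 t.1.1.2.1 t.1.1.2.2 t.1.2 t.2) := by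
  have hctx : CodeFP (pairE SE natE) (pairE unE (pairE pcE pcE)) (fun t => t.1.1) := (fst _ _).fst'
  have hy : CodeFP (pairE SE natE) strE (fun t => t.1.2) := (fst _ _).snd'
  have hnU : CodeFP (pairE SE natE) unE (fun t => t.1.1.1) := (fst _ _).fst'.fst'
  have hn : CodeFP (pairE SE natE) natE (fun t => t.1.1.1) := natOfUn.comp hnU
  have hr : CodeFP (pairE SE natE) natE (fun t => t.2) := snd _ _
  have hrn : CodeFP (pairE SE natE) natE (fun t => t.2 * t.1.1.1) := natMul.comp (hr.pair hn)
  have hw : CodeFP (pairE SE natE) bitsE (fun t => coinVec t.1.2 t.1.1.1 (t.2 * t.1.1.1)) :=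
    coinVec_codeFP.comp (hy.pair (hnU.pair hrn))
  have hR := roundY_codeFP.comp (hctx.pair hw)
  refine hR.congr fun t => ?_
  dsimp only [roundAt]

/-- The sum of the rounds on codes. [cite: AroraBarak2009, §1.3] -/
theorem sumY_codeFP : CodeFP SE intE (fun t => sumY t.1.1 t.1.2.1 t.1.2.2 t.2) := by
  have hm := CodeFP.map (σ := (ℕ × (PCirc × PCirc)) × List Bool) (eσ := SE) (eα := natE) (eβ := intE)
    (g := fun t => roundAt t.1.1.1 t.1.1.2.1 t.1.1.2.2 t.1.2 t.2) roundAt_codeFP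
  have hS := intSum.comp (hm.comp ((CodeFP.id _).pair (const _ (List.range N))))
  refine hS.congr fun t => ?_
  dsimp only [sumY]
  rfl

/-- **The decision on codes.** [cite: AroraBarak2009, §1.3] -/
theorem accept_codeFP (j : ℕ) : CodeFP (pairE instE strE) bitE (fun p => accept j p.1 (instE p.1).length p.2) := by
  have ht : CodeFP (pairE instE strE) instE (fun p => p.1) := fst _ _
  have hy : CodeFP (pairE instE strE) strE (fun p => p.2) := snd _ _
  have hL1 : CodeFP (pairE instE strE) unE (fun p => (instE p.1).length + 1) := unSucc.comp (instLen_codeFP.comp ht)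
  have hn : CodeFP (pairE instE strE) natE (fun p => p.1.1) := instN_codeFP.comp ht
  have hk : CodeFP (pairE instE strE) bitE (fun p => decide (p.1.2.1 = 2)) := natEq.comp ((instK_codeFP.comp ht).pair (const _ 2))
  have hg : CodeFP (pairE instE strE) bitE (fun p => decide (p.1.1 ≤ (instE p.1).length + 1)) := natLeUn.comp (hn.pair hL1)
  have hne : CodeFP (pairE instE strE) unE (fun p => nEff p.1 (instE p.1).length) := (unOfNatMin.comp (hL1.pair hn)).congr fun _ => rfl
  have hc : ∀ i : ℕ, CodeFP (pairE instE strE) pcE (fun p => circAt p.1 i) := fun i => circAt_codeFP.comp (ht.pair (const _ i))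
  have hs := sumY_codeFP.comp ((hne.pair ((hc (1 - j)).pair (hc j))).pair hy)
  have hpos := intLt.comp ((const (pairE instE strE) (0 : ℤ)).pair hs)
  have hall := hk.and (hg.and hpos)
  refine hall.congr fun p => ?_
  dsimp only [accept]

/-- **The decision on genuine instance codes** is computed in polynomial time. [cite: AroraBarak2009, §1.3] -/
theorem acceptI_codeFP (j : ℕ) : CodeFP (pairE KForrelationInstance.encode strE) bitE
    (fun p => accept j (instOf p.1) p.1.encode.length p.2) := by
  have h := (accept_codeFP j).comp ((instOf_codeFP.comp (fst KForrelationInstance.encode strE)).pair (snd _ _))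
  refine h.congr fun p => ?_
  dsimp only
  rw [encode_eq]

/-! ### The `FP` witness and the language in `P` -/

/-- A polynomial-time string function computing the decision on instance codes. [cite: AroraBarak2009, §1.3] -/
def accF (j : ℕ) : List Bool → List Bool := Classical.choose (acceptI_codeFP j)

/-- `accF ∈ FP`. [cite: AroraBarak2009, §1.3] -/
theorem accF_mem_FP (j : ℕ) : accF j ∈ FP := (Classical.choose_spec (acceptI_codeFP j)).1

/-- `accF` on instance codes. [cite: AroraBarak2009, §1.3] -/
theorem accF_encode (j : ℕ) (I : KForrelationInstance) (y : List Bool) :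
    accF j (boolPair I.encode y) = [accept j (instOf I) I.encode.length y] :=
  (Classical.choose_spec (acceptI_codeFP j)).2 (I, y)

/-- The decider normalised to one bit on every string. [cite: Goldreich2006, Def. 1.2] -/
def dec (j : ℕ) : List Bool → List Bool := eqPairFn ∘ fanoutFn (accF j) (fun _ => [true])

/-- `dec ∈ FP`. [cite: AroraBarak2009, §1.3] -/
theorem dec_mem_FP (j : ℕ) : dec j ∈ FP :=
  comp_mem_FP eqPairFn_mem_FP (fanoutFn_mem_FP (accF_mem_FP j) (const_mem_FP _))

/-- `dec` is one-bit. [folklore] -/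
theorem oneBit_dec (j : ℕ) : OneBit (dec j) := OneBit.comp oneBit_eqPairFn _

/-- `dec` tests `accF z = [true]`. [folklore] -/
theorem dec_apply (j : ℕ) (z : List Bool) : dec j z = [decide (accF j z = [true])] := by
  rw [dec, Function.comp_apply, fanoutFn_apply, eqPairFn_boolPair]

/-- The decider on instance codes. [cite: AaronsonAmbainis2018, §1.1.3] -/
theorem dec_encode (j : ℕ) (I : KForrelationInstance) (y : List Bool) :
    dec j (boolPair I.encode y) = [accept j (instOf I) I.encode.length y] := by
  rw [dec_apply, accF_encode]
  cases accept j (instOf I) I.encode.length y <;> rfl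

/-- **Promise-`BPP` membership from acceptance bounds of the machine.** [cite: Goldreich2006, Def. 1.2] -/
theorem mem_PromiseBPP'_of_accept (j : ℕ) (Q : PromiseProblem) (p : Polynomial ℕ)
    (hyes : ∀ I : KForrelationInstance, I.encode ∈ Q.yes →
      (2 / 3 : ℝ) ≤ uniformProb (p.eval I.encode.length) {y | accept j (instOf I) I.encode.length y = true})
    (hno : ∀ I : KForrelationInstance, I.encode ∈ Q.no →
      (2 / 3 : ℝ) ≤ uniformProb (p.eval I.encode.length) {y | accept j (instOf I) I.encode.length y = false})
    (hY : ∀ x ∈ Q.yes, ∃ I : KForrelationInstance, I.encode = x)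
    (hN : ∀ x ∈ Q.no, ∃ I : KForrelationInstance, I.encode = x) : Q ∈ PromiseBPP' := by
  refine Q.mem_PromiseBPP'_of_fp_decider (dec_mem_FP j) (oneBit_dec j) p (fun x hx => ?_) (fun x hx => ?_)
  · obtain ⟨I, rfl⟩ := hY x hx
    refine (hyes I hx).trans_eq (congrArg _ (Set.ext fun y => ?_))
    show accept j (instOf I) I.encode.length y = true ↔ dec j (boolPair I.encode y) = [true]
    rw [dec_encode]; cases accept j (instOf I) I.encode.length y <;> simp
  · obtain ⟨I, rfl⟩ := hN x hx
    refine (hno I hx).trans_eq (congrArg _ (Set.ext fun y => ?_))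
    show accept j (instOf I) I.encode.length y = false ↔ dec j (boolPair I.encode y) = [false]
    rw [dec_encode]; cases accept j (instOf I) I.encode.length y <;> simp

/-! ### The statistic and its two moments -/

section Stat

open Finset

variable {n : ℕ}

/-- `IsDegLeFun 2 g` in the sampler's vocabulary: `[g] ∈ lowDeg n 2`. [cite: Carlet2020, §2.2.1] -/
theorem lowDeg_two_of_isDegLeFun {g : (Fin n → Bool) → Bool} (hg : IsDegLeFun 2 g) :
    QuadPolar.toZFun g ∈ CHHL2018.lowDeg n 2 := by
  obtain ⟨p, hp, hf⟩ := hg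
  exact QuadPolar.toZFun_mem_lowDeg_of_poly p hp hf

/-- The sampler's `walsh` is the tree's unnormalised Walsh transform `W` of `(-1)^g`. [folklore] -/
theorem walsh_eq_W (g : (Fin n → Bool) → Bool) (u : Fin n → Bool) :
    walsh g u = DerivativeWalsh.W (fun y => signOf (g y)) u := by
  unfold walsh DerivativeWalsh.W
  refine sum_congr rfl fun x _ => ?_
  rw [sgnZ_toZFun, twist_comm]

/-- **The one-round statistic** `Z(w) = (-1)^{f(u)} · 2ⁿ / W_g(u)`, `u = uV g w`. [cite: AaronsonAmbainis2018, §1.1.1] -/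
def Zst (f g : (Fin n → Bool) → Bool) (w : Fin n → Bool) : ℝ :=
  signOf (f (uV g w)) * (2 : ℝ) ^ n / walsh g (uV g w)

/-- **First moment**: `Σ_w Z(w) = S(f,g) = √(2^{3n}) · Φ(f,g)` (the sampler is exact: the weights
`W_g(u)²/4ⁿ` cancel one `W_g(u)`). [cite: AaronsonAmbainis2018, §1.1.1] -/
theorem sum_Zst_eq {f g : (Fin n → Bool) → Bool} (hg : IsDegLeFun 2 g) :
    ∑ w, Zst f g w = Real.sqrt ((2 : ℝ) ^ (3 * n)) * forrelation f g := by
  have key := sum_comp_uV_mul_two_pow (lowDeg_two_of_isDegLeFun hg)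
    (fun u => signOf (f u) * (2 : ℝ) ^ n / walsh g u)
  have h1 : (∑ w, Zst f g w) * 2 ^ n =
      2 ^ n * DerivativeWalsh.fsum (fun x => signOf (f x)) (fun y => signOf (g y)) := by
    rw [show (fun w => Zst f g w) = fun w => signOf (f (uV g w)) * (2 : ℝ) ^ n / walsh g (uV g w) from rfl,
      key, DerivativeWalsh.fsum_eq_sum_mul_W, mul_sum]
    refine sum_congr rfl fun u _ => ?_
    rw [sq_mul_div_self, walsh_eq_W]; ring
  have h2 : (2 : ℝ) ^ n ≠ 0 := pow_ne_zero _ two_ne_zero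
  have h3 : ∑ w, Zst f g w = DerivativeWalsh.fsum (fun x => signOf (f x)) (fun y => signOf (g y)) := by
    apply mul_right_cancel₀ h2; rw [h1]; ring
  rw [h3, ← BuzetChailloux.phi_signOf, DerivativeWalsh.phi_eq_fsum, ← mul_assoc,
    mul_inv_cancel₀ (by positivity), one_mul]

/-- **Second moment**: `Σ_w Z(w)² ≤ 2ⁿ · 2ⁿ` (at most `2ⁿ` support points, each weighing `4ⁿ`).
[cite: AaronsonAmbainis2018, §1.1.1] -/
theorem sum_Zst_sq_le {f g : (Fin n → Bool) → Bool} (hg : IsDegLeFun 2 g) :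
    ∑ w, Zst f g w ^ 2 ≤ (2 : ℝ) ^ n * 2 ^ n := by
  have key := sum_comp_uV_mul_two_pow (lowDeg_two_of_isDegLeFun hg)
    (fun u => (signOf (f u) * (2 : ℝ) ^ n / walsh g u) ^ 2)
  have h1 : (∑ w, Zst f g w ^ 2) * 2 ^ n ≤ ∑ _u : Fin n → Bool, ((2 : ℝ) ^ n) ^ 2 := by
    rw [show (fun w => Zst f g w ^ 2) = fun w => (signOf (f (uV g w)) * (2 : ℝ) ^ n / walsh g (uV g w)) ^ 2
      from rfl, key]
    refine sum_le_sum fun u _ => ?_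
    refine (sq_mul_div_sq_le _ _).trans ?_
    rw [mul_pow, BuzetChailloux.signOf_sq, one_mul]
  have hc : ∑ _u : Fin n → Bool, ((2 : ℝ) ^ n) ^ 2 = (2 ^ n * 2 ^ n) * 2 ^ n := by
    simp only [sum_const, card_univ, Fintype.card_fun, Fintype.card_bool, Fintype.card_fin, nsmul_eq_mul,
      Nat.cast_pow, Nat.cast_ofNat]
    ring
  rw [hc] at h1
  exact le_of_mul_le_mul_right h1 (pow_pos two_pos n)

/-- `√(2^{3n}) = 2ⁿ · √(2ⁿ)`. [folklore] -/
theorem sqrt_two_pow_three_mul_eq (n : ℕ) : Real.sqrt ((2 : ℝ) ^ (3 * n)) = 2 ^ n * Real.sqrt (2 ^ n) := by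
  rw [show (2 : ℝ) ^ (3 * n) = (2 ^ n) ^ 2 * 2 ^ n by ring, Real.sqrt_mul (by positivity),
    Real.sqrt_sq (by positivity)]

/-- **The normalised statistic** `Zₙ = Z / √(2ⁿ)`: mean `Φ`, second moment `≤ 1`. [cite: AaronsonAmbainis2018, §1.1.1] -/
def Zn (f g : (Fin n → Bool) → Bool) (w : Fin n → Bool) : ℝ := Zst f g w * (Real.sqrt ((2 : ℝ) ^ n))⁻¹

/-- `Σ_w Zₙ(w) = 2ⁿ · Φ(f,g)`. [cite: AaronsonAmbainis2018, §1.1.1] -/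
theorem sum_Zn_eq {f g : (Fin n → Bool) → Bool} (hg : IsDegLeFun 2 g) :
    ∑ w, Zn f g w = (2 : ℝ) ^ n * forrelation f g := by
  unfold Zn
  rw [← sum_mul, sum_Zst_eq hg, sqrt_two_pow_three_mul_eq]
  have hs : Real.sqrt ((2 : ℝ) ^ n) ≠ 0 := Real.sqrt_ne_zero'.2 (by positivity)
  field_simp

/-- `Σ_w Zₙ(w)² ≤ 2ⁿ · 1`. [cite: AaronsonAmbainis2018, §1.1.1] -/
theorem sum_Zn_sq_le {f g : (Fin n → Bool) → Bool} (hg : IsDegLeFun 2 g) :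
    ∑ w, Zn f g w ^ 2 ≤ (2 : ℝ) ^ n * 1 := by
  unfold Zn
  have e : ∀ w, (Zst f g w * (Real.sqrt ((2 : ℝ) ^ n))⁻¹) ^ 2 = Zst f g w ^ 2 * (2 ^ n)⁻¹ := by
    intro w; rw [mul_pow, inv_pow, Real.sq_sqrt (by positivity)]
  simp_rw [e]
  rw [← sum_mul]
  have h := sum_Zst_sq_le (f := f) hg
  have h2 : (0 : ℝ) < 2 ^ n := pow_pos two_pos n
  calc (∑ w, Zst f g w ^ 2) * ((2 : ℝ) ^ n)⁻¹ ≤ (2 ^ n * 2 ^ n) * ((2 : ℝ) ^ n)⁻¹ :=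
        mul_le_mul_of_nonneg_right h (by positivity)
    _ = 2 ^ n * 1 := by field_simp

/-- `Φ(f,g) = Φ(g,f)`. [cite: AaronsonAmbainis2018, §1.1.1] -/
theorem forrelation_comm (f g : (Fin n → Bool) → Bool) : forrelation f g = forrelation g f := by
  rw [← BuzetChailloux.phi_signOf, ← BuzetChailloux.phi_signOf, DerivativeWalsh.phi_eq_fsum,
    DerivativeWalsh.phi_eq_fsum, DerivativeWalsh.fsum_eq_sum_mul_W, DerivativeWalsh.fsum_eq_sum_mul_W']

end Stat

/-! ### Bridges used by the sequel -/

section Bridges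

variable {m : ℕ}

/-- The machine's oracle of a circuit code is the lifted Boolean function. [folklore] -/
theorem evalP_pcircOf_eq_liftQ (Q : Circuit (Fin m)) : evalP (pcircOf Q) = liftQ Q.eval :=
  funext fun v => evalP_pcircOf_eq Q v

/-- The coin polynomial `p(L) = N (L + 1)` (`N` blocks of `n ≤ L + 1` coins). [folklore] -/
def coinPoly : Polynomial ℕ := Polynomial.C N * (Polynomial.X + 1)

/-- `p(L) = N (L + 1)`. [folklore] -/
theorem coinPoly_eval (L : ℕ) : coinPoly.eval L = N * (L + 1) := by simp [coinPoly]

/-- The circuits of a two-circuit instance at the machine's positions, `j = 1`: sign from `C₀`,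
oracle `C₁`. [folklore] -/
theorem circuits_one (I : KForrelationInstance) (hk : I.k = 2) :
    circAt (instOf I) (1 - 1) = pcircOf (C₀ I hk) ∧ circAt (instOf I) 1 = pcircOf (C₁ I hk) :=
  ⟨circAt_zero I hk, circAt_one I hk⟩

/-- … `j = 0`: sign from `C₁`, oracle `C₀`. [folklore] -/
theorem circuits_zero (I : KForrelationInstance) (hk : I.k = 2) :
    circAt (instOf I) (1 - 0) = pcircOf (C₁ I hk) ∧ circAt (instOf I) 0 = pcircOf (C₀ I hk) :=
  ⟨circAt_one I hk, circAt_zero I hk⟩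

/-- `PromiseBPP'` is antitone in the promise (local copy of the `LatticeOWF.lean` lemma). [cite: Goldreich2006, §1.1] -/
theorem mem_PromiseBPP'_of_subset {Q Q' : PromiseProblem} (hy : Q'.yes ≤ Q.yes) (hn : Q'.no ≤ Q.no)
    (h : Q ∈ PromiseBPP') : Q' ∈ PromiseBPP' := by
  obtain ⟨L', hL', p, hyes, hno⟩ := h
  exact ⟨L', hL', p, fun x hx => hyes x (hy hx), fun x hx => hno x (hn hx)⟩

end Bridges


end HalfQuad

end Summit.QuantumAdvantage.QuantumAdvantage.Theorems.SignedCubicForrelationNotPrBPP.Negative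

end
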